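import Literature.MathematicalPhysics.QuantumFieldTheory.Balaban1983to89.B8Ineq125Concrete
import Literature.MathematicalPhysics.QuantumFieldTheory.Balaban1983to89.B7Prop10General
import Literature.MathematicalPhysics.QuantumFieldTheory.Balaban1983to89.B7Prop3Flat
import Literature.MathematicalPhysics.QuantumFieldTheory.Balaban1983to89.B7Prop2Explicit
import HarnessLib

/-!
# `hP1room` PROGRAMME (LEAD-H BOARD «H = hSupUρ»), row (N05-WINDOWS) — PRELIMINARIES: the constants at `d = 3`, two exponential bounds, the monomial
# budgets of the master smallness, and the FIRST∕SECOND-ORDER SIZES of the top-step letters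

Route `UnitScaleTilt`, crux K1 child «MinimiserStabilityRegPr» (stmt-QuantumFields-19200), registered stub `stub_halvingStep` (`BirthV10`).  Cell `ym3-torus`
(HUMAN RULING D-0037: YM₃ on T³ is ladder rung R3 — NOT d = 4, NOT a mass gap, NOT the Clay problem); width seat `ym-t4-w13` g0, row named by LEAD-H ★w5-19200 g5
(2026-08-28 16:39Z).  `--supports stmt-QuantumFields-19200 --as helper`; THEOREMS ONLY (0 `def`, 0 `sorry`); PURE REAL ARITHMETIC, count-neutral; nothing here claims
`hSupU`, `hP1room`, the stub, the crux or the gap.  Consumer: `UnitScaleTiltHalvingHSupURhoWindows` (the one ∃-statement `exists_topCall_constants_of_rhoWindow`).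

LETTERS (as in that file): `ℓ = L`, `s = (ρ′+M′+1)ε₀`, `X₀ = 1 + B₀ + B₀⁻¹`, `Y = (1+B₀'H)(1+B₂')(1+BG)(1+BR)`, `V = ℓ³X₀Y·s`; `α₁ = 198s + 27s/(ℓB₀)`,
`cstar = 15ℓB₀(ε₀+α₁)`, `B₀' = B₀'H + 15ℓ²BG·BR + 3BG·BR·B₂'`, `α₄ = 8B₀'·cstar`, `cB = ℓ·cstar`, `cDA = 3ℓ²·cstar`, `Cl = 2C′₂(3)(120cB + 2α₄)`,
`Cb = C′₂(3)(120cB + α₄)α₄`, `C′₂(3) = 579 944 448`.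

References: T. Bałaban, CMP **99** (1985) 75–102 [Balaban1985RegularSpaces] (Thm 4 p.88, Prop. 3 p.87, (1.103) p.93, Prop. 5 p.94, (1.121) p.96); CMP **98** (1985)
17–51 [Balaban1985Averaging] (Prop. 2 (54) p.26, Prop. 3 p.36, Prop. 9 p.49, (203)–(214) pp.49–50).
-/

set_option autoImplicit false

noncomputable section

namespace Summit.QuantumFields.YangMills.Theorems.HalvingHSupURhoWindowsPrelim

open Literature.MathematicalPhysics.QuantumFieldTheory.Balaban1983to89
open B7Prop2Explicit (C0 c2')
open B7Prop3Flat (c3)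
open B7Prop9Flat (C5' C4')
open B7Prop10Flat (C5)
open B7Prop10General (C6 C7 C4G)
open B7Eq214General (Cgen)
open B8Ineq125Concrete (C2p)

/-! ## §1 The constants at `d = 3` (closed forms) -/

/-- `C₀(3) = 226·(8·4·7)² = 11 339 776`. [cite: Balaban1985Averaging, Prop. 2 (54) p.26] (elementary arithmetic; our evaluation) -/
theorem C0_three : C0 3 = 11339776 := by norm_num [C0]

/-- `c′₂(3, L) = (14 336·L²)⁻¹`. [cite: Balaban1985Averaging, Prop. 2 p.26] (elementary arithmetic; our evaluation) -/
theorem c2'_three (L : ℕ) : c2' 3 L = 1 / (14336 * (L : ℝ) ^ 2) := by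
  rw [c2']; norm_num

/-- `c₃(3, L) = (512·L)⁻¹`. [cite: Balaban1985Averaging, Prop. 3 p.36] (elementary arithmetic; our evaluation) -/
theorem c3_three (L : ℕ) : c3 3 L = 1 / (512 * (L : ℝ)) := by
  rw [c3]; norm_num

/-- `C′₅(3) = 256`. [cite: Balaban1985Averaging, Prop. 9 p.49] (elementary arithmetic; our evaluation) -/
theorem C5'_three : C5' 3 = 256 := by norm_num [C5']

/-- `C₆(3) = 1026`. [cite: Balaban1985Averaging, (204) p.49] (elementary arithmetic; our evaluation) -/
theorem C6_three : C6 3 = 1026 := by norm_num [C6, C5, C5']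

/-- `C₄(3, L) = 1 050 624·L + 69 069 312`. [cite: Balaban1985Averaging, (203)–(205) p.49] (elementary arithmetic; our evaluation) -/
theorem C4G_three (L : ℕ) : C4G 3 L = 1050624 * (L : ℝ) + 69069312 := by
  rw [C4G, C7, C6_three, C4', C5']; norm_num; ring

/-- `C′₂(3) = 579 944 448`. [cite: Balaban1985RegularSpaces, (1.121) p.96] (elementary arithmetic; our evaluation) -/
theorem C2p_three : C2p 3 = 579944448 := by
  rw [C2p, Cgen, C6_three]; norm_num

/-! ## §2 Two elementary exponential bounds (via Mathlib's `Real.abs_exp_sub_one_le`) -/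

/-- `e^{ηc} − 1 ≤ η·(2c)` for `η, c ∈ [0, 1]` — the shape of `hSupBlock_of_topRows`' `hc₁` with `c₁ := η·c⋆`, `c′ := 2c⋆`.
[cite: Balaban1985Variational, (152) p.301] (elementary analysis; our proof) -/
theorem exp_mul_sub_one_le {η c : ℝ} (hη0 : 0 ≤ η) (hη1 : η ≤ 1) (hc0 : 0 ≤ c) (hc1 : c ≤ 1) :
    Real.exp (η * c) - 1 ≤ η * (2 * c) := by
  have h0 : 0 ≤ η * c := mul_nonneg hη0 hc0
  have h1 : η * c ≤ 1 := by nlinarith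
  -- `e^x ≤ 1 + 2x` on `[0,1]` (Mathlib's `Real.abs_exp_sub_one_le`; the named form lives in `Literature.NumberTheory.Sieve`)
  have h := Real.abs_exp_sub_one_le (x := η * c) (by rw [abs_of_nonneg h0]; exact h1)
  rw [abs_of_nonneg h0] at h
  have h' := (abs_le.mp h).2
  linarith

/-- `exp(4·(800·4²·7)·ε₀) ≤ 9/8` once `10⁸ε₀ ≤ 1` (the exponential factor of Prop. 3's `hsmall`∕`hC₂` at `d = 3`).
[cite: Balaban1985RegularSpaces, Prop. 3 p.87] (elementary analysis; our proof) -/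
theorem exp_window_three {ε₀ : ℝ} (hε₀ : 0 ≤ ε₀) (hε : 10 ^ 8 * ε₀ ≤ 1) :
    Real.exp (4 * (800 * ((3 : ℝ) + 1) ^ 2 * ((3 : ℝ) + 4)) * ε₀) ≤ 9 / 8 := by
  have hx : 4 * (800 * ((3 : ℝ) + 1) ^ 2 * ((3 : ℝ) + 4)) * ε₀ = 358400 * ε₀ := by norm_num
  rw [hx]
  have hx0 : 0 ≤ 358400 * ε₀ := by positivity
  have hx1 : 358400 * ε₀ ≤ 1 / 16 := by linarith
  have h := Real.abs_exp_sub_one_le (x := 358400 * ε₀) (by rw [abs_of_nonneg hx0]; linarith)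
  rw [abs_of_nonneg hx0] at h
  have h' := (abs_le.mp h).2
  linarith

/-- Prop. 3's `hsmall` at `d = 3`: `exp(…α₀)·(1 + 8(131072·4²)·y) ≤ 2` once `10⁸ε₀ ≤ 1`, `10⁸y ≤ 1` (`y` = `2(L·c⋆)+8α₄` or `cB`).
[cite: Balaban1985RegularSpaces, Prop. 3 p.87] (elementary analysis; our proof) -/
theorem hsmall_window {ε₀ y : ℝ} (hε₀ : 0 ≤ ε₀) (hε : 10 ^ 8 * ε₀ ≤ 1) (hy0 : 0 ≤ y) (hy : 10 ^ 8 * y ≤ 1) :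
    Real.exp (4 * (800 * ((3 : ℝ) + 1) ^ 2 * ((3 : ℝ) + 4)) * ε₀) * (1 + 8 * (131072 * ((3 : ℝ) + 1) ^ 2) * y) ≤ 2 := by
  have hexp := exp_window_three hε₀ hε
  have hK : 8 * (131072 * ((3 : ℝ) + 1) ^ 2) = 16777216 := by norm_num
  rw [hK]
  have h1 : 1 + 16777216 * y ≤ 3 / 2 := by linarith
  have h2 : 0 ≤ 1 + 16777216 * y := by positivity
  exact (mul_le_mul hexp h1 h2 (by norm_num)).trans (by norm_num)

/-- Prop. 3's `hC₂` at `d = 3` with `C₂ := 33 554 432 = 16·(131072·4²)`: `8(131072·4²)·exp(…α₀) ≤ C₂` once `10⁸ε₀ ≤ 1`.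
[cite: Balaban1985RegularSpaces, Prop. 3 p.87] (elementary analysis; our proof) -/
theorem hC2_window {ε₀ : ℝ} (hε₀ : 0 ≤ ε₀) (hε : 10 ^ 8 * ε₀ ≤ 1) :
    8 * (131072 * ((3 : ℝ) + 1) ^ 2) * Real.exp (4 * (800 * ((3 : ℝ) + 1) ^ 2 * ((3 : ℝ) + 4)) * ε₀) ≤ 33554432 := by
  have hexp := exp_window_three hε₀ hε
  have hK : 8 * (131072 * ((3 : ℝ) + 1) ^ 2) = 16777216 := by norm_num
  rw [hK]
  exact (mul_le_mul_of_nonneg_left hexp (by norm_num)).trans (by norm_num)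

/-! ## §3 The monomial budgets dropped from the master smallness -/

/-- **Budgets.**  From `10²⁶ℓ⁶X₀²Y⁵(1+c)s ≤ 1` (`ℓ, X₀, Y ≥ 1`, `c, s ≥ 0`): `10⁸ℓ²s`, `10¹²ℓ³X₀²Y(1+c)s`, `10¹⁹ℓ⁴X₀²Y²s`, `10²³ℓ⁶X₀²Y²s`, `10¹⁸ℓ³X₀Y⁵s`
are all `≤ 1`, and `s ≤ 1`. [cite: Balaban1985RegularSpaces, Thm 4 p.88] (elementary arithmetic; our proof) -/
theorem budgets {ℓ X₀ Y c s : ℝ} (hℓ1 : 1 ≤ ℓ) (hX₀1 : 1 ≤ X₀) (hY1 : 1 ≤ Y) (hc0 : 0 ≤ c) (hs0 : 0 ≤ s)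
    (hW : (10 : ℝ) ^ 26 * ℓ ^ 6 * X₀ ^ 2 * Y ^ 5 * (1 + c) * s ≤ 1) :
    10 ^ 8 * ℓ ^ 2 * s ≤ 1 ∧ 10 ^ 12 * ℓ ^ 3 * X₀ ^ 2 * Y * (1 + c) * s ≤ 1 ∧ 10 ^ 19 * ℓ ^ 4 * X₀ ^ 2 * Y ^ 2 * s ≤ 1 ∧
      10 ^ 23 * ℓ ^ 6 * X₀ ^ 2 * Y ^ 2 * s ≤ 1 ∧ 10 ^ 18 * ℓ ^ 3 * X₀ * Y ^ 5 * s ≤ 1 ∧ s ≤ 1 := by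
  have hX₀2 : 1 ≤ X₀ ^ 2 := one_le_pow₀ hX₀1
  have hX₀sq : X₀ ^ 1 ≤ X₀ ^ 2 := pow_le_pow_right₀ hX₀1 (by norm_num)
  have hY5 : 1 ≤ Y ^ 5 := one_le_pow₀ hY1
  have hℓ6 : 1 ≤ ℓ ^ 6 := one_le_pow₀ hℓ1
  have hc1 : 1 ≤ 1 + c := by linarith
  have key : ∀ A : ℝ, A ≤ (10 : ℝ) ^ 26 * ℓ ^ 6 * X₀ ^ 2 * Y ^ 5 * (1 + c) → A * s ≤ 1 :=
    fun A hA => (mul_le_mul_of_nonneg_right hA hs0).trans hW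
  refine ⟨?_, ?_, ?_, ?_, ?_, ?_⟩
  · refine key _ ?_
    calc (10 : ℝ) ^ 8 * ℓ ^ 2 = (10 : ℝ) ^ 8 * ℓ ^ 2 * 1 * 1 * 1 := by ring
      _ ≤ (10 : ℝ) ^ 26 * ℓ ^ 6 * X₀ ^ 2 * Y ^ 5 * (1 + c) := by gcongr <;> norm_num
  · refine key _ ?_
    calc (10 : ℝ) ^ 12 * ℓ ^ 3 * X₀ ^ 2 * Y * (1 + c) = (10 : ℝ) ^ 12 * ℓ ^ 3 * X₀ ^ 2 * Y ^ 1 * (1 + c) := by ring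
      _ ≤ (10 : ℝ) ^ 26 * ℓ ^ 6 * X₀ ^ 2 * Y ^ 5 * (1 + c) := by gcongr <;> norm_num
  · refine key _ ?_
    calc (10 : ℝ) ^ 19 * ℓ ^ 4 * X₀ ^ 2 * Y ^ 2 = (10 : ℝ) ^ 19 * ℓ ^ 4 * X₀ ^ 2 * Y ^ 2 * 1 := by ring
      _ ≤ (10 : ℝ) ^ 26 * ℓ ^ 6 * X₀ ^ 2 * Y ^ 5 * (1 + c) := by gcongr <;> norm_num
  · refine key _ ?_
    calc (10 : ℝ) ^ 23 * ℓ ^ 6 * X₀ ^ 2 * Y ^ 2 = (10 : ℝ) ^ 23 * ℓ ^ 6 * X₀ ^ 2 * Y ^ 2 * 1 := by ring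
      _ ≤ (10 : ℝ) ^ 26 * ℓ ^ 6 * X₀ ^ 2 * Y ^ 5 * (1 + c) := by gcongr <;> norm_num
  · refine key _ ?_
    calc (10 : ℝ) ^ 18 * ℓ ^ 3 * X₀ * Y ^ 5 = (10 : ℝ) ^ 18 * ℓ ^ 3 * X₀ ^ 1 * Y ^ 5 * 1 := by ring
      _ ≤ (10 : ℝ) ^ 26 * ℓ ^ 6 * X₀ ^ 2 * Y ^ 5 * (1 + c) := by gcongr <;> norm_num
  · have h1 : (1 : ℝ) ≤ (10 : ℝ) ^ 26 * ℓ ^ 6 * X₀ ^ 2 * Y ^ 5 * (1 + c) := by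
      calc (1 : ℝ) = 1 * 1 * 1 * 1 * 1 := by ring
        _ ≤ (10 : ℝ) ^ 26 * ℓ ^ 6 * X₀ ^ 2 * Y ^ 5 * (1 + c) := by gcongr; norm_num
    have h := key 1 h1
    linarith

/-! ## §4 The product letter `Y` -/

/-- **`Y = (1+B₀'H)(1+B₂')(1+BG)(1+BR)` dominates the monomials the sizes read.** [cite: Balaban1985RegularSpaces, Prop. 5 p.94] (elementary; our proof) -/
theorem Y_letters {B₀'H B₂' BG BR Y : ℝ} (hB₀'H : 0 ≤ B₀'H) (hB₂' : 0 ≤ B₂') (hBG : 0 ≤ BG) (hBR : 0 ≤ BR)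
    (hY : Y = (1 + B₀'H) * (1 + B₂') * (1 + BG) * (1 + BR)) :
    1 ≤ Y ∧ B₀'H ≤ Y ∧ B₂' ≤ Y ∧ BG ≤ Y ∧ BR ≤ Y ∧ BG * BR ≤ Y ∧ BG * BR * B₂' ≤ Y ∧ B₀'H + BG * BR + BG * BR * B₂' ≤ Y := by
  have hYexp : Y = 1 + B₀'H + B₂' + BG + BR + B₀'H * B₂' + B₀'H * BG + B₀'H * BR + B₂' * BG + B₂' * BR + BG * BR +
      B₀'H * B₂' * BG + B₀'H * B₂' * BR + B₀'H * BG * BR + B₂' * BG * BR + B₀'H * B₂' * BG * BR := by rw [hY]; ring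
  have h1 := mul_nonneg hB₀'H hB₂'
  have h2 := mul_nonneg hB₀'H hBG
  have h3 := mul_nonneg hB₀'H hBR
  have h4 := mul_nonneg hB₂' hBG
  have h5 := mul_nonneg hB₂' hBR
  have h6 := mul_nonneg hBG hBR
  have h7 := mul_nonneg h1 hBG
  have h8 := mul_nonneg h1 hBR
  have h9 := mul_nonneg h2 hBR
  have h10 := mul_nonneg h4 hBR
  have h11 := mul_nonneg h7 hBR
  have hlow : B₀'H + BG * BR + BG * BR * B₂' + B₂' + BG + BR + 1 ≤ Y := by rw [hYexp]; linarith
  refine ⟨by linarith, by linarith, by linarith, by linarith, by linarith, by linarith, by linarith, by linarith⟩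

/-! ## §5 First-order sizes of the letters -/

set_option maxHeartbeats 400000 in
/-- **First-order sizes** of `α₁, cstar, B₀', α₄, cB, cDA, t = 2(ℓ·cstar)+8α₄, Q = ε₀+120cB+8α₄, Cl` against `s` and `V = ℓ³X₀Y·s`.
[cite: Balaban1985RegularSpaces, Thm 4 p.88, Prop. 5 p.94, (1.121) p.96] (elementary arithmetic; our proof) -/
theorem sizes {ℓ B₀ X₀ Y B₀'H B₂' BG BR s ε₀ α₁ cstar B₀' α₄ cB cDA Cl : ℝ}
    (hℓ1 : 1 ≤ ℓ) (hB₀ : 0 < B₀) (hX₀1 : 1 ≤ X₀) (hB₀X : B₀ ≤ X₀) (hBiX : B₀⁻¹ ≤ X₀)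
    (hY1 : 1 ≤ Y) (hB₀'H : 0 < B₀'H) (hB₂' : 0 ≤ B₂') (hBG : 0 ≤ BG) (hBR : 0 ≤ BR) (hYlow : B₀'H + BG * BR + BG * BR * B₂' ≤ Y)
    (hs0 : 0 < s) (hε₀ : 0 < ε₀) (hεs : ε₀ ≤ s)
    (hα₁ : α₁ = 198 * s + 27 * s / (ℓ * B₀)) (hcs : cstar = 15 * ℓ * B₀ * (ε₀ + α₁))
    (hB₀' : B₀' = B₀'H + 15 * ℓ ^ 2 * BG * BR + 3 * BG * BR * B₂') (hα₄ : α₄ = 8 * B₀' * cstar)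
    (hcB : cB = ℓ * cstar) (hcDA : cDA = 3 * ℓ ^ 2 * cstar) (hCl : Cl = 2 * 579944448 * (120 * cB + 2 * α₄)) :
    198 * s ≤ α₁ ∧ α₁ ≤ 225 * X₀ * s ∧ 405 * s ≤ cstar ∧ cstar ≤ 3390 * ℓ * X₀ * s ∧ 0 < cstar ∧
      B₀'H ≤ B₀' ∧ 15 * ℓ ^ 2 * BG * BR ≤ B₀' ∧ 3 * BG * BR * B₂' ≤ B₀' ∧ B₀' ≤ 15 * ℓ ^ 2 * Y ∧ 0 < B₀' ∧
      3240 * B₀' * s ≤ α₄ ∧ α₄ ≤ 2 * 10 ^ 6 * (ℓ ^ 3 * X₀ * Y * s) ∧ 0 < α₄ ∧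
      cB ≤ 3390 * (ℓ ^ 3 * X₀ * Y * s) ∧ cDA ≤ 10170 * (ℓ ^ 3 * X₀ * Y * s) ∧
      2 * (ℓ * cstar) + 8 * α₄ ≤ 2 * 10 ^ 7 * (ℓ ^ 3 * X₀ * Y * s) ∧ ε₀ + 120 * cB + 8 * α₄ ≤ 2 * 10 ^ 7 * (ℓ ^ 3 * X₀ * Y * s) ∧
      Cl ≤ 10 ^ 16 * (ℓ ^ 3 * X₀ * Y * s) ∧ s ≤ ℓ ^ 3 * X₀ * Y * s ∧ cstar ≤ 3390 * (ℓ ^ 3 * X₀ * Y * s) := by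
  have hℓ0 : 0 ≤ ℓ := by linarith
  have hX₀0 : 0 ≤ X₀ := by linarith
  have hY0 : 0 ≤ Y := by linarith
  have hℓB0 : 0 < ℓ * B₀ := by positivity
  have hBGBR : 0 ≤ BG * BR := mul_nonneg hBG hBR
  have hBGBRB : 0 ≤ BG * BR * B₂' := mul_nonneg hBGBR hB₂'
  have hℓBGBR : 0 ≤ 15 * ℓ ^ 2 * BG * BR := by positivity
  have hfracE : 15 * ℓ * B₀ * (27 * s / (ℓ * B₀)) = 405 * s := by field_simp; norm_num
  have hfrac : 27 * s / (ℓ * B₀) ≤ 27 * (B₀⁻¹ * s) := by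
    rw [div_le_iff₀ hℓB0]
    have h1 : B₀⁻¹ * s * (ℓ * B₀) = ℓ * s := by field_simp
    have h2 : 27 * (B₀⁻¹ * s) * (ℓ * B₀) = 27 * (ℓ * s) := by rw [← h1]; ring
    rw [h2]
    have := mul_nonneg (sub_nonneg.mpr hℓ1) hs0.le
    linarith
  have hfrac0 : 0 ≤ 27 * s / (ℓ * B₀) := by positivity
  have hBis : B₀⁻¹ * s ≤ X₀ * s := mul_le_mul_of_nonneg_right hBiX hs0.le
  have hXs : s ≤ X₀ * s := by have := mul_nonneg (sub_nonneg.mpr hX₀1) hs0.le; linarith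
  have hα₁L : 198 * s ≤ α₁ := by rw [hα₁]; linarith
  have hα₁U : α₁ ≤ 225 * X₀ * s := by rw [hα₁]; linarith
  have hcsE : cstar = 15 * ℓ * B₀ * ε₀ + 2970 * ℓ * B₀ * s + 405 * s := by
    rw [hcs, mul_add, show 15 * ℓ * B₀ * α₁ = 15 * ℓ * B₀ * (198 * s) + 15 * ℓ * B₀ * (27 * s / (ℓ * B₀)) by rw [hα₁]; ring, hfracE]
    ring
  have hℓB₀ε : 0 ≤ ℓ * B₀ * ε₀ := by positivity
  have hℓB₀s : 0 ≤ ℓ * B₀ * s := by positivity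
  have hcsL : 405 * s ≤ cstar := by rw [hcsE]; linarith
  have hcs0 : 0 < cstar := by linarith
  have hℓX1 : 1 ≤ ℓ * X₀ := one_le_mul_of_one_le_of_one_le hℓ1 hX₀1
  have hcsU : cstar ≤ 3390 * ℓ * X₀ * s := by
    rw [hcsE]
    have h1 : ℓ * (B₀ * ε₀) ≤ ℓ * (X₀ * s) := mul_le_mul_of_nonneg_left (mul_le_mul hB₀X hεs hε₀.le hX₀0) hℓ0
    have h2 : ℓ * (B₀ * s) ≤ ℓ * (X₀ * s) := mul_le_mul_of_nonneg_left (mul_le_mul_of_nonneg_right hB₀X hs0.le) hℓ0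
    have h3 : 0 ≤ (ℓ * X₀ - 1) * s := mul_nonneg (sub_nonneg.mpr hℓX1) hs0.le
    linarith
  have hℓsq1 : 1 ≤ ℓ ^ 2 := one_le_pow₀ hℓ1
  have hB₀'L1 : B₀'H ≤ B₀' := by rw [hB₀']; linarith
  have hB₀'0 : 0 < B₀' := lt_of_lt_of_le hB₀'H hB₀'L1
  have hB₀'L2 : 15 * ℓ ^ 2 * BG * BR ≤ B₀' := by rw [hB₀']; linarith
  have hB₀'L3 : 3 * BG * BR * B₂' ≤ B₀' := by rw [hB₀']; linarith
  have hB₀'U : B₀' ≤ 15 * ℓ ^ 2 * Y := by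
    rw [hB₀']
    have p1 := mul_nonneg (by linarith : (0 : ℝ) ≤ 15 * ℓ ^ 2 - 1) hB₀'H.le
    have p2 := mul_nonneg (by linarith : (0 : ℝ) ≤ 15 * ℓ ^ 2 - 3) hBGBRB
    have p3 := mul_le_mul_of_nonneg_left hYlow (by positivity : (0 : ℝ) ≤ 15 * ℓ ^ 2)
    linarith
  have hα₄0 : 0 < α₄ := by rw [hα₄]; positivity
  have hα₄L : 3240 * B₀' * s ≤ α₄ := by
    rw [hα₄]; have := mul_le_mul_of_nonneg_left hcsL (by positivity : (0 : ℝ) ≤ 8 * B₀'); linarith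
  -- the unit `V = ℓ³X₀Y·s`
  have hV1 : ℓ * X₀ * s ≤ ℓ ^ 3 * X₀ * Y * s := by
    have : ℓ ^ 1 * X₀ * 1 ≤ ℓ ^ 3 * X₀ * Y := by gcongr; norm_num
    have := mul_le_mul_of_nonneg_right this hs0.le
    rw [pow_one, mul_one] at this; exact this
  have hV2 : ℓ ^ 2 * X₀ * s ≤ ℓ ^ 3 * X₀ * Y * s := by
    have : ℓ ^ 2 * X₀ * 1 ≤ ℓ ^ 3 * X₀ * Y := by gcongr; norm_num
    have := mul_le_mul_of_nonneg_right this hs0.le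
    rw [mul_one] at this; exact this
  have hV3 : ℓ ^ 3 * X₀ * s ≤ ℓ ^ 3 * X₀ * Y * s := by
    have : ℓ ^ 3 * X₀ * 1 ≤ ℓ ^ 3 * X₀ * Y := by gcongr
    have := mul_le_mul_of_nonneg_right this hs0.le
    rw [mul_one] at this; exact this
  have hV0 : s ≤ ℓ ^ 3 * X₀ * Y * s := by
    have h1 : (1 : ℝ) ≤ ℓ ^ 3 * X₀ * Y := by
      calc (1 : ℝ) = 1 * 1 * 1 := by ring
        _ ≤ ℓ ^ 3 * X₀ * Y := by gcongr; exact one_le_pow₀ hℓ1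
    have := mul_nonneg (sub_nonneg.mpr h1) hs0.le
    linarith
  have hVnn : 0 ≤ ℓ ^ 3 * X₀ * Y * s := by positivity
  have hcsV : cstar ≤ 3390 * (ℓ ^ 3 * X₀ * Y * s) := by linarith
  have hα₄U : α₄ ≤ 2 * 10 ^ 6 * (ℓ ^ 3 * X₀ * Y * s) := by
    rw [hα₄]
    have h := mul_le_mul hB₀'U hcsU hcs0.le (by positivity)
    linarith
  have hcBU : cB ≤ 3390 * (ℓ ^ 3 * X₀ * Y * s) := by
    rw [hcB]; have := mul_le_mul_of_nonneg_left hcsU hℓ0; linarith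
  have hcDAU : cDA ≤ 10170 * (ℓ ^ 3 * X₀ * Y * s) := by
    rw [hcDA]; have h := mul_le_mul_of_nonneg_left hcsU (by positivity : (0 : ℝ) ≤ ℓ ^ 2); linarith
  have htU : 2 * (ℓ * cstar) + 8 * α₄ ≤ 2 * 10 ^ 7 * (ℓ ^ 3 * X₀ * Y * s) := by rw [← hcB]; linarith
  have hQU : ε₀ + 120 * cB + 8 * α₄ ≤ 2 * 10 ^ 7 * (ℓ ^ 3 * X₀ * Y * s) := by linarith
  have hClU : Cl ≤ 10 ^ 16 * (ℓ ^ 3 * X₀ * Y * s) := by rw [hCl]; linarith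
  exact ⟨hα₁L, hα₁U, hcsL, hcsU, hcs0, hB₀'L1, hB₀'L2, hB₀'L3, hB₀'U, hB₀'0, hα₄L, hα₄U, hα₄0, hcBU, hcDAU, htU, hQU, hClU, hV0, hcsV⟩

/-! ## §6 Second-order facts -/

set_option maxHeartbeats 400000 in
/-- **Second order**: `Cb ≤ s`, `2B₀'H·Cb ≤ α₄` (i.e. `hCbρ`), and Prop. 3's `h61` in both currencies (`t = 2(ℓcstar)+8α₄` and `cstar`).
[cite: Balaban1985RegularSpaces, Prop. 3 (1.61) p.87, Prop. 5 p.94] (elementary arithmetic; our proof) -/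
theorem second_order {ℓ X₀ Y s ε₀ α₁ cstar α₄ cB Cb B₀'H C₂ : ℝ}
    (hℓ1 : 1 ≤ ℓ) (hX₀1 : 1 ≤ X₀) (hY1 : 1 ≤ Y) (hs0 : 0 < s) (hε₀ : 0 < ε₀) (hεs : ε₀ ≤ s) (hB₀'HY : B₀'H ≤ Y)
    (hα₁L : 198 * s ≤ α₁) (hcs0 : 0 < cstar) (hα₄0 : 0 < α₄) (hcB0 : 0 ≤ cB)
    (hα₄U : α₄ ≤ 2 * 10 ^ 6 * (ℓ ^ 3 * X₀ * Y * s)) (htU : 2 * (ℓ * cstar) + 8 * α₄ ≤ 2 * 10 ^ 7 * (ℓ ^ 3 * X₀ * Y * s))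
    (hQU : ε₀ + 120 * cB + 8 * α₄ ≤ 2 * 10 ^ 7 * (ℓ ^ 3 * X₀ * Y * s)) (hV0 : s ≤ ℓ ^ 3 * X₀ * Y * s)
    (hCb : Cb = 579944448 * (120 * cB + α₄) * α₄) (hC₂ : C₂ = 33554432)
    (hW4 : 10 ^ 19 * ℓ ^ 4 * X₀ ^ 2 * Y ^ 2 * s ≤ 1) (hW5 : 10 ^ 23 * ℓ ^ 6 * X₀ ^ 2 * Y ^ 2 * s ≤ 1) :
    0 ≤ Cb ∧ Cb ≤ s ∧ 2 * B₀'H * Cb ≤ α₄ ∧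
      2 * (2 * (ℓ * cstar) + 8 * α₄) ^ 2 + 20 * (3 : ℝ) * ε₀ * (2 * (ℓ * cstar) + 8 * α₄) + 2 * C₂ * (2 * (ℓ * cstar) + 8 * α₄) ^ 2 ≤ ε₀ + α₁ ∧
      2 * cstar ^ 2 + 20 * (3 : ℝ) * ε₀ * cstar + 2 * C₂ * cstar ^ 2 ≤ ε₀ + α₁ := by
  have hℓ0 : 0 ≤ ℓ := by linarith
  have hX₀0 : 0 ≤ X₀ := by linarith
  have hY0 : 0 ≤ Y := by linarith
  set V : ℝ := ℓ ^ 3 * X₀ * Y * s with hV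
  have hVpos : 0 ≤ V := by positivity
  have hVV : V * V ≤ s / 10 ^ 23 := by
    have : V * V = (ℓ ^ 6 * X₀ ^ 2 * Y ^ 2 * s) * s := by rw [hV]; ring
    rw [this, le_div_iff₀ (by norm_num : (0 : ℝ) < 10 ^ 23)]
    nlinarith
  have hYV : Y * V ≤ 1 / 10 ^ 19 := by
    have h1 : Y * V = ℓ ^ 3 * X₀ ^ 1 * Y ^ 2 * s := by rw [hV]; ring
    have h2 : ℓ ^ 3 * X₀ ^ 1 * Y ^ 2 * s ≤ ℓ ^ 4 * X₀ ^ 2 * Y ^ 2 * s := by gcongr <;> norm_num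
    rw [h1, le_div_iff₀ (by norm_num : (0 : ℝ) < 10 ^ 19)]
    linarith
  have hCb0 : 0 ≤ Cb := by rw [hCb]; positivity
  have hQ' : 120 * cB + α₄ ≤ 2 * 10 ^ 7 * V := by linarith
  have hCbU : Cb ≤ s := by
    rw [hCb]
    have h1 : (579944448 : ℝ) * (120 * cB + α₄) * α₄ ≤ 579944448 * (2 * 10 ^ 7 * V) * (2 * 10 ^ 6 * V) := by
      gcongr
    nlinarith
  have hCbρ : 2 * B₀'H * Cb ≤ α₄ := by
    rw [hCb]
    have h1 : 2 * B₀'H * ((579944448 : ℝ) * (120 * cB + α₄)) ≤ 2 * Y * (579944448 * (2 * 10 ^ 7 * V)) := by gcongr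
    have h2 : 2 * Y * ((579944448 : ℝ) * (2 * 10 ^ 7 * V)) ≤ 1 := by nlinarith
    calc 2 * B₀'H * (579944448 * (120 * cB + α₄) * α₄) = (2 * B₀'H * (579944448 * (120 * cB + α₄))) * α₄ := by ring
      _ ≤ 1 * α₄ := mul_le_mul_of_nonneg_right (h1.trans h2) hα₄0.le
      _ = α₄ := one_mul _
  set t : ℝ := 2 * (ℓ * cstar) + 8 * α₄ with ht
  have ht0 : 0 ≤ t := by positivity
  have h61a : 2 * t ^ 2 + 20 * (3 : ℝ) * ε₀ * t + 2 * C₂ * t ^ 2 ≤ ε₀ + α₁ := by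
    rw [hC₂]
    have h1 : t * t ≤ (2 * 10 ^ 7 * V) * (2 * 10 ^ 7 * V) := mul_le_mul htU htU ht0 (by positivity)
    have h2 : ε₀ * t ≤ s * (2 * 10 ^ 7 * V) := mul_le_mul hεs htU ht0 hs0.le
    have h3 : s * V ≤ s / 10 ^ 23 := le_trans (mul_le_mul_of_nonneg_right hV0 hVpos) hVV
    nlinarith
  have h61b : 2 * cstar ^ 2 + 20 * (3 : ℝ) * ε₀ * cstar + 2 * C₂ * cstar ^ 2 ≤ ε₀ + α₁ := by
    have hct : cstar ≤ t := by
      rw [ht]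
      have := mul_le_mul_of_nonneg_right hℓ1 hcs0.le
      linarith
    have hC₂0 : 0 ≤ C₂ := by rw [hC₂]; norm_num
    have h1 := mul_le_mul hct hct hcs0.le ht0
    have h2 := mul_le_mul_of_nonneg_left hct hε₀.le
    have h3 := mul_le_mul_of_nonneg_left h1 hC₂0
    nlinarith
  exact ⟨hCb0, hCbU, hCbρ, h61a, h61b⟩

end Summit.QuantumFields.YangMills.Theorems.HalvingHSupURhoWindowsPrelim

end
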